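import Literature.NumberTheory.EllipticCurves.X049CMSigmaSqTwoProofs
import Literature.NumberTheory.EllipticCurves.PadicSigmaUniquenessProofs
import Literature.NumberTheory.EllipticCurves.FormalMulTwoSecondCoeffProofs
import Literature.NumberTheory.EllipticCurves.FormalGroupMultiplication
import Literature.NumberTheory.EllipticCurves.FormalGroupFrobeniusTypeAllPrimesProofs
import Literature.NumberTheory.EllipticCurves.FormalGroupDictionaryProofs
import HarnessLib

/-!
# Uniqueness of the Mazur–Tate sigma(-squared) pair at EVERY prime: finite height ⟹ unbounded
denominators of `log`; `X₀(49)` at `p = 2` binder-free (proofs only)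

Topic `NumberTheory/EllipticCurves` (theorems only; no definition, no named fact). Mazur–Tate 1991,
Thm. 3.1 / Mazur–Stein–Tate 2006, Thm. 1.3 («exactly one») / Silverman 2005, §5 Rem. 2 («unique»)
assert that the `p`-adic sigma function of an ordinary elliptic curve is UNIQUE among odd normalised
solutions of `x + c = -D(Dσ/σ)` with BOUNDED (integral) coefficients. The tree proves this
uniqueness for the pair `(σ, c)` (`IsMazurTateSigmaPair.unique_of_unbounded_formalLog`,
`PadicSigmaUniquenessProofs.lean`) from the hypothesis «the coefficients of `log_W` are `p`-adically
unbounded», and supplies that hypothesis only at good ordinary `p ≥ 5`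
(`unbounded_formalLog_of_good_ordinary`, through the Hasse invariant). This file

* §1–§2 proves the hypothesis at EVERY prime from FINITE HEIGHT alone:
  `unbounded_formalLog_of_norm_coeff_formalMul_eq_one` — if `[p](t) ∈ tℤ_p⟦t⟧` has a unit
  coefficient (`[p]˜ ≠ 0`) then `log_V` has unbounded coefficients. Proof: otherwise
  `M = p^N log_V ∈ ℤ_p⟦t⟧` satisfies `M([p]t) = p·M(t)`; but an integral solution of `M ∘ ι = a·M`,
  `‖a‖ < 1`, along an integral `ι` with nonzero reduction is `0` — compare the coefficient of
  `t^{k₀d}` (`k₀`, `d` the first unit coefficients of `ι`, `M`): it is `≡ M_d ι_{k₀}^d ≢ 0` on the left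
  and `≡ 0` on the right (`eq_zero_of_subst_eq_C_mul`). Instances: `p = 2` with `a₁ ∈ ℤ₂ˣ`
  (`[2](t) = 2t - a₁t² + ⋯`; `unbounded_formalLog_two_of_norm_a₁_eq_one`) and every `ℤ_p`-model with
  elliptic fibres (`unbounded_formalLog_of_isElliptic_toZMod`, via the tree's all-primes finite height
  `exists_isUnit_coeff_formalMul'`), whence `IsMazurTateSigmaPair.unique_of_isElliptic_toZMod`.
* §3 proves the SQUARED twin `IsMazurTateSigmaSqPair.unique_of_unbounded_formalLog`: two
  sigma-squared pairs `(Σᵢ, cᵢ)` (`PadicSigmaSq.lean`) of a `p`-integral `V/ℚ_p` with unbounded `log_V`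
  coincide. Writing `Σᵢ = σᵢ²` (`IsMazurTateSigmaSqPair.exists_sq_eq`; `σᵢ` need NOT be integral —
  at `p = 2` it is not), `2(c₁ - c₂)·log_V = -(2g₁ - 2g₂)'`-wise with `2gᵢ = tΣᵢ'/(ωΣᵢ) ∈ ℤ_p⟦t⟧`
  (`norm_two_mul_sub_mul_coeff_formalLog_le`), so `c₁ = c₂`; and two normalised odd solutions with the
  same constant coincide by the Wronskian argument of `IsMazurTateSigmaPair.eq_of_const_eq` with its
  unused integrality field removed (`eq_of_satisfiesSigmaODE_of_isFormallyOdd`).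
* §4, `p = 2`: `IsMazurTateSigmaSqPair.unique_two_of_norm_a₁_eq_one` — **uniqueness of the
  sigma-squared pair at `2` for `a₁` odd, with NO printed-fact binder** (the tree's
  `IsMazurTateSigmaSqPair.unique_two` takes `mazurTate_sigmaSq_existsUnique_two`); and for
  `X₀(49) = [1,-1,0,-2,-1]`, where existence is `cm7_exists_isMazurTateSigmaSqPair_sq_two`
  (Perrin-Riou's CM sigma function, `X049CMSigmaSqTwoProofs`): `cm7_existsUnique_isMazurTateSigmaSqPair_two`
  (`∃!` binder-free), **`cm7_padicSigmaSq_eq_sq_two'` — `padicSigmaSq (X₀(49) ⊗ ℚ₂) = σ_CM²` and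
  `padicSigmaSqConst = 0` with no hypothesis at all** (statement (L1) «`σ_MT² = σ_CM²`» of the
  Goldfeld cell at `p = 2`, now a closed theorem), `cm7_padicSigmaSqConst_two`.

What is NOT claimed: existence of a sigma(-squared) pair for a general ordinary curve (Mazur–Tate 1991
§2; the named facts `mazur_tate_sigma_existsUnique`, `mazurTate_sigmaSq_existsUnique_two` keep their
existence content); the link good reduction at `p` of a globally minimal `W/ℚ` ⟹ elliptic `ℤ_p`-fibres
is not re-plumbed here (see `PadicSigmaUniquenessOrdinaryProofs`).

## References
* [Mazur–Tate 1991] B. Mazur, J. Tate, *The `p`-adic sigma function*, Duke Math. J. 62 (1991), Thm. 3.1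
  (uniqueness among functions with bounded coefficients). [cite: MazurTate1991, Thm. 3.1]
* [Mazur–Stein–Tate 2006] *Computation of `p`-adic heights and log convergence*, Thm. 1.3, Rem. 1.4, §3.1.
  [cite: MazurSteinTate2006, Thm. 1.3]
* [Silverman 2005] J. H. Silverman, *`p`-adic properties of division polynomials and elliptic divisibility
  sequences*, Math. Ann. 332 (2005), §5 Rem. 2. [cite: Silverman2005DivPoly, §5 Rem. 2]
* [Silverman AEC] *The Arithmetic of Elliptic Curves*, 2nd ed., IV.2.3 (`[2](t) = 2t - a₁t² - ⋯`),
  IV.5.5 (`log = Σ cₙtⁿ/n`), IV.6.1, IV.7.2 (height of the reduced formal group is `1` or `2`).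
  [cite: SilvermanAEC2009, IV.7.2]
* [Perrin-Riou 1984] B. Perrin-Riou, Mém. SMF 17, Ch. III §1.2 (p. 54: «le lemme suivant se déduit des
  résultats de Mazur et Tate sur les fonctions σ p-adiques»). [cite: Perrinriou1984, Ch. III §1.2 Lemme 2]
-/

noncomputable section

open PowerSeries Literature.NumberTheory.EllipticCurves

namespace Literature.NumberTheory.EllipticCurves

variable {p : ℕ} [Fact p.Prime]

/-! ### §1. `M(ι) = a·M` with `‖a‖ < 1` along an integral substitution of nonzero reduction forces `M = 0` -/

/-- Ultrametric inequality for finite sums, strict form. [folklore] -/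
private theorem norm_sum_lt_one {ι : Type*} (s : Finset ι) (f : ι → ℚ_[p])
    (h : ∀ i ∈ s, ‖f i‖ < 1) : ‖∑ i ∈ s, f i‖ < 1 :=
  Finset.sum_induction f (fun x => ‖x‖ < 1)
    (fun a b ha hb => (Padic.nonarchimedean a b).trans_lt (max_lt ha hb))
    (by simp) h

/-- If `‖ι_i‖ < 1` for `i < k₀` (and `ι ∈ ℤ_p⟦X⟧`) then `‖[X^m] ιⁿ‖ < 1` for `m < k₀n`
(`ιⁿ ≡ ι_{k₀}ⁿ X^{k₀n} + ⋯ (mod p)`). [folklore] -/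
private theorem norm_coeff_pow_lt_one {ι : ℚ_[p]⟦X⟧} {k₀ : ℕ} (hι : IsPadicInt ι)
    (hk : ∀ i < k₀, ‖coeff i ι‖ < 1) :
    ∀ n m : ℕ, m < k₀ * n → ‖coeff m (ι ^ n)‖ < 1 := by
  have hι' := isPadicInt_iff_coeff.mp hι
  intro n
  induction n with
  | zero => intro m hm; simp at hm
  | succ n ih =>
    intro m hm
    rw [pow_succ', coeff_mul]
    refine norm_sum_lt_one _ _ fun ij hij => ?_
    have hsum : ij.1 + ij.2 = m := Finset.HasAntidiagonal.mem_antidiagonal.mp hij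
    rw [norm_mul]
    by_cases h1 : ij.1 < k₀
    · exact mul_lt_one_of_nonneg_of_lt_one_left (norm_nonneg _) (hk _ h1)
        ((isPadicInt_iff_coeff.mp (hι.pow n)) _)
    · have h2 : ij.2 < k₀ * n := by
        push Not at h1
        have e : k₀ * (n + 1) = k₀ * n + k₀ := by ring
        omega
      exact mul_lt_one_of_nonneg_of_lt_one_right (hι' _) (norm_nonneg _) (ih _ h2)

/-- … and `[X^{k₀n}] ιⁿ ≡ ι_{k₀}ⁿ (mod p)`. [folklore] -/
private theorem norm_coeff_pow_sub_lt_one {ι : ℚ_[p]⟦X⟧} {k₀ : ℕ} (hι : IsPadicInt ι)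
    (hk : ∀ i < k₀, ‖coeff i ι‖ < 1) :
    ∀ n : ℕ, ‖coeff (k₀ * n) (ι ^ n) - coeff k₀ ι ^ n‖ < 1 := by
  have hι' := isPadicInt_iff_coeff.mp hι
  intro n
  induction n with
  | zero => simp
  | succ n ih =>
    have hmem : (k₀, k₀ * n) ∈ Finset.HasAntidiagonal.antidiagonal (k₀ * (n + 1)) := by
      rw [Finset.HasAntidiagonal.mem_antidiagonal]; ring
    have hsplit : coeff (k₀ * (n + 1)) (ι ^ (n + 1)) - coeff k₀ ι ^ (n + 1) =
        (∑ x ∈ (Finset.HasAntidiagonal.antidiagonal (k₀ * (n + 1))).erase (k₀, k₀ * n),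
            coeff x.1 ι * coeff x.2 (ι ^ n)) +
          coeff k₀ ι * (coeff (k₀ * n) (ι ^ n) - coeff k₀ ι ^ n) := by
      rw [pow_succ', coeff_mul, Finset.sum_erase_eq_sub hmem]
      ring
    rw [hsplit]
    refine (Padic.nonarchimedean _ _).trans_lt (max_lt ?_ ?_)
    · refine norm_sum_lt_one _ _ fun ij hij => ?_
      obtain ⟨hne, hij'⟩ := Finset.mem_erase.mp hij
      have hsum : ij.1 + ij.2 = k₀ * (n + 1) := Finset.HasAntidiagonal.mem_antidiagonal.mp hij'
      rw [norm_mul]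
      by_cases h1 : ij.1 < k₀
      · exact mul_lt_one_of_nonneg_of_lt_one_left (norm_nonneg _) (hk _ h1)
          ((isPadicInt_iff_coeff.mp (hι.pow n)) _)
      · have h2 : ij.2 < k₀ * n := by
          push Not at h1
          have e : k₀ * (n + 1) = k₀ * n + k₀ := by ring
          rcases h1.lt_or_eq with hlt | heq
          · omega
          · exfalso
            apply hne
            have h2' : ij.2 = k₀ * n := by omega
            exact Prod.ext heq.symm h2'
        exact mul_lt_one_of_nonneg_of_lt_one_right (hι' _) (norm_nonneg _)
          (norm_coeff_pow_lt_one hι hk n _ h2)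
    · rw [norm_mul]
      exact mul_lt_one_of_nonneg_of_lt_one_right (hι' _) (norm_nonneg _) ih

/-- **Reduction step.** Let `ι ∈ Xℤ_p⟦X⟧` have a unit coefficient (`ι ≢ 0 (mod p)`), `M ∈ ℤ_p⟦X⟧`,
`‖a‖ < 1` and `M(ι) = a·M`. Then every coefficient of `M` lies in `pℤ_p`: if `M_d` were the first
unit coefficient and `ι_{k₀}` the first unit coefficient of `ι`, the coefficient of `X^{k₀d}` in
`M(ι)` would be `≡ M_d ι_{k₀}^d ≢ 0`, while `a·M ≡ 0`. [folklore] -/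
private theorem norm_coeff_lt_one_of_subst_eq_C_mul {ι M : ℚ_[p]⟦X⟧} {a : ℚ_[p]} {k₀ : ℕ}
    (hι0 : constantCoeff ι = 0) (hι : IsPadicInt ι) (hk : ∀ i < k₀, ‖coeff i ι‖ < 1)
    (hk₀ : ‖coeff k₀ ι‖ = 1) (hM : IsPadicInt M) (ha : ‖a‖ < 1) (hfe : M.subst ι = C a * M) :
    ∀ d, ‖coeff d M‖ < 1 := by
  classical
  have hM' := isPadicInt_iff_coeff.mp hM
  have hk₀pos : 0 < k₀ := by
    rcases Nat.eq_zero_or_pos k₀ with h | h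
    · subst h
      rw [coeff_zero_eq_constantCoeff, hι0, norm_zero] at hk₀
      exact absurd hk₀ zero_ne_one
    · exact h
  by_contra hcon
  push Not at hcon
  let d := Nat.find hcon
  have hd : 1 ≤ ‖coeff d M‖ := Nat.find_spec hcon
  have hd1 : ‖coeff d M‖ = 1 := le_antisymm (hM' d) hd
  have hlt : ∀ n < d, ‖coeff n M‖ < 1 := fun n hn => lt_of_not_ge (Nat.find_min hcon hn)
  have key := congrArg (coeff (k₀ * d)) hfe
  rw [coeff_subst_eq_sum_range hι0, coeff_C_mul] at key
  have hmem : d ∈ Finset.range (k₀ * d + 1) :=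
    Finset.mem_range.mpr (Nat.lt_succ_of_le (Nat.le_mul_of_pos_left d hk₀pos))
  rw [← Finset.add_sum_erase _ _ hmem] at key
  -- the main term has norm `1`
  have hmain : ‖coeff (k₀ * d) (ι ^ d) * coeff d M‖ = 1 := by
    have e : coeff (k₀ * d) (ι ^ d) * coeff d M =
        coeff k₀ ι ^ d * coeff d M + (coeff (k₀ * d) (ι ^ d) - coeff k₀ ι ^ d) * coeff d M := by ring
    have h1 : ‖coeff k₀ ι ^ d * coeff d M‖ = 1 := by
      rw [norm_mul, norm_pow, hk₀, one_pow, hd1, mul_one]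
    have h2 : ‖(coeff (k₀ * d) (ι ^ d) - coeff k₀ ι ^ d) * coeff d M‖ < 1 := by
      rw [norm_mul, hd1, mul_one]; exact norm_coeff_pow_sub_lt_one hι hk d
    rw [e, Padic.add_eq_max_of_ne (by rw [h1]; exact h2.ne'), h1, max_eq_left h2.le]
  -- the other terms are small
  have hrest : ‖∑ n ∈ (Finset.range (k₀ * d + 1)).erase d, coeff (k₀ * d) (ι ^ n) * coeff n M‖ < 1 := by
    refine norm_sum_lt_one _ _ fun n hn => ?_
    obtain ⟨hne, -⟩ := Finset.mem_erase.mp hn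
    rw [norm_mul]
    rcases lt_or_gt_of_ne hne with hlt' | hgt
    · exact mul_lt_one_of_nonneg_of_lt_one_right ((isPadicInt_iff_coeff.mp (hι.pow n)) _)
        (norm_nonneg _) (hlt n hlt')
    · exact mul_lt_one_of_nonneg_of_lt_one_left (norm_nonneg _)
        (norm_coeff_pow_lt_one hι hk n _ (Nat.mul_lt_mul_of_pos_left hgt hk₀pos)) (hM' n)
  have hL : ‖coeff (k₀ * d) (ι ^ d) * coeff d M +
      ∑ n ∈ (Finset.range (k₀ * d + 1)).erase d, coeff (k₀ * d) (ι ^ n) * coeff n M‖ = 1 := by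
    rw [Padic.add_eq_max_of_ne (by rw [hmain]; exact hrest.ne'), hmain, max_eq_left hrest.le]
  have hR : ‖a * coeff (k₀ * d) M‖ < 1 := by
    rw [norm_mul]; exact mul_lt_one_of_nonneg_of_lt_one_left (norm_nonneg _) ha (hM' _)
  rw [key] at hL
  exact absurd hL hR.ne

/-- `(C r)(T) = C r`, stated inside `ℚ_p⟦X⟧`. [folklore] -/
private theorem C_subst' (r : ℚ_[p]) (T : ℚ_[p]⟦X⟧) :
    (C r : ℚ_[p]⟦X⟧).subst T = C r := by
  rw [subst_C]; rfl

/-- **`M(ι) = a·M`, `‖a‖ < 1`, `ι ∈ Xℤ_p⟦X⟧` with a unit coefficient, `M ∈ ℤ_p⟦X⟧` ⟹ `M = 0`**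
(iterate the reduction step on `p⁻¹M`, which satisfies the same equation). [folklore] -/
private theorem eq_zero_of_subst_eq_C_mul {ι M : ℚ_[p]⟦X⟧} {a : ℚ_[p]} {k₀ : ℕ}
    (hι0 : constantCoeff ι = 0) (hι : IsPadicInt ι) (hk : ∀ i < k₀, ‖coeff i ι‖ < 1)
    (hk₀ : ‖coeff k₀ ι‖ = 1) (hM : IsPadicInt M) (ha : ‖a‖ < 1) (hfe : M.subst ι = C a * M) :
    M = 0 := by
  have hp1 : (1 : ℝ) < p := by exact_mod_cast (Fact.out : p.Prime).one_lt
  have hp0 : (0 : ℝ) < p := by positivity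
  have hsι : HasSubst ι := HasSubst.of_constantCoeff_zero' hι0
  -- all `p^{-N} M` are integral
  have step : ∀ N : ℕ, IsPadicInt (C (((p : ℚ_[p])⁻¹) ^ N) * M) := by
    intro N
    induction N with
    | zero => rw [pow_zero, map_one, one_mul]; exact hM
    | succ N ih =>
      have hfeN : (C (((p : ℚ_[p])⁻¹) ^ N) * M).subst ι = C a * (C (((p : ℚ_[p])⁻¹) ^ N) * M) := by
        rw [subst_mul hsι, C_subst' _ ι, hfe]; ring
      have hlt := norm_coeff_lt_one_of_subst_eq_C_mul hι0 hι hk hk₀ ih ha hfeN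
      rw [isPadicInt_iff_coeff]
      intro d
      have h := hlt d
      rw [coeff_C_mul] at h ⊢
      rw [pow_succ, mul_comm (_ ^ N), mul_assoc, norm_mul, norm_inv, Padic.norm_p]
      have h' : ‖((p : ℚ_[p])⁻¹) ^ N * coeff d M‖ ≤ (p : ℝ) ^ (-1 : ℤ) := by
        rw [Padic.norm_le_pow_iff_norm_lt_pow_add_one]; simpa using h
      rw [zpow_neg_one] at h'
      calc (p : ℝ)⁻¹⁻¹ * ‖((p : ℚ_[p])⁻¹) ^ N * coeff d M‖ ≤ (p : ℝ)⁻¹⁻¹ * (p : ℝ)⁻¹ := by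
            gcongr
        _ = 1 := by rw [inv_inv, mul_inv_cancel₀ hp0.ne']
  ext d
  rw [map_zero]
  by_contra hne
  have hpos : 0 < ‖coeff d M‖ := norm_pos_iff.mpr hne
  obtain ⟨N, hN⟩ := exists_pow_lt_of_lt_one hpos (inv_lt_one_of_one_lt₀ hp1)
  have h := isPadicInt_iff_coeff.mp (step N) d
  rw [coeff_C_mul, norm_mul, norm_pow, norm_inv, Padic.norm_p, inv_inv] at h
  -- `p^N ‖M_d‖ ≤ 1` contradicts `p^{-N} < ‖M_d‖`
  have h2 : (p : ℝ) ^ N * ‖coeff d M‖ > (p : ℝ) ^ N * ((p : ℝ)⁻¹) ^ N :=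
    mul_lt_mul_of_pos_left hN (pow_pos hp0 N)
  rw [← mul_pow, mul_inv_cancel₀ hp0.ne', one_pow] at h2
  linarith

end Literature.NumberTheory.EllipticCurves

namespace WeierstrassCurve

variable {p : ℕ} [Fact p.Prime]

/-! ### §2. Finite height forces unbounded denominators of the formal logarithm -/

/-- **Finite height ⟹ `log` has `p`-adically unbounded coefficients.** For a `p`-integral
Weierstrass equation `V/ℚ_p` whose multiplication-by-`p` series `[p](t) ∈ tℤ_p⟦t⟧` has SOME `p`-adic
unit coefficient (i.e. `[p]˜ ≠ 0` in `𝔽_p⟦t⟧`: the formal group has finite height — automatic at a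
prime of good reduction, `exists_isUnit_coeff_formalMul'`), the coefficients of `log_V` are unbounded:
otherwise `M = p^N·log_V ∈ ℤ_p⟦t⟧` would satisfy `M([p]t) = p·M` (`log_V([p]t) = p·log_V(t)`), and an
integral solution of `M ∘ ι = a·M`, `‖a‖ < 1`, along an integral `ι` of nonzero reduction vanishes
(compare the first unit coefficient of `M` with that of `M(ι)`). This is the «bounded coefficients»
input of Mazur–Tate's uniqueness at EVERY prime, `p = 2, 3` included (the tree's
`unbounded_formalLog_of_good_ordinary` needs `p ≥ 5`). [Mazur–Tate 1991, Thm. 3.1 (uniqueness among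
bounded functions); Silverman AEC IV.5.5, IV.7] [cite: SilvermanAEC2009, IV.7.2] -/
theorem unbounded_formalLog_of_norm_coeff_formalMul_eq_one (V : WeierstrassCurve ℚ_[p])
    [V.IsIntegral ℤ_[p]] (hk : ∃ k, ‖coeff k (V.formalMul p)‖ = 1) :
    ∀ N : ℕ, ∃ m, (p : ℝ) ^ N < ‖coeff m V.formalLog‖ := by
  classical
  have hprime : p.Prime := Fact.out
  set k₀ := Nat.find hk with hk₀def
  have hk₀ : ‖coeff k₀ (V.formalMul p)‖ = 1 := Nat.find_spec hk
  have hlt : ∀ i < k₀, ‖coeff i (V.formalMul p)‖ < 1 := fun i hi =>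
    lt_of_le_of_ne ((isPadicInt_iff_coeff.mp (V.isPadicInt_formalMul p)) i) (Nat.find_min hk hi)
  intro N
  by_contra hcon
  push Not at hcon
  have hp0 : (0 : ℝ) < p := by exact_mod_cast hprime.pos
  set M : ℚ_[p]⟦X⟧ := C ((p : ℚ_[p]) ^ N) * V.formalLog with hM
  have hMint : IsPadicInt M := by
    rw [isPadicInt_iff_coeff]
    intro m
    rw [hM, coeff_C_mul, norm_mul, norm_pow, Padic.norm_p]
    calc ((p : ℝ)⁻¹) ^ N * ‖coeff m V.formalLog‖ ≤ ((p : ℝ)⁻¹) ^ N * (p : ℝ) ^ N := by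
          gcongr; exact hcon m
      _ = 1 := by rw [← mul_pow, inv_mul_cancel₀ hp0.ne', one_pow]
  have hs := V.hasSubst_formalMul p
  have hfe : M.subst (V.formalMul p) = C (p : ℚ_[p]) * M := by
    rw [hM, subst_mul hs, Literature.NumberTheory.EllipticCurves.C_subst' _ (V.formalMul p),
      V.formalLog_subst_formalMul p, nsmul_eq_mul, map_natCast]
    ring
  have h0 := Literature.NumberTheory.EllipticCurves.eq_zero_of_subst_eq_C_mul
    (V.constantCoeff_formalMul p) (V.isPadicInt_formalMul p) hlt hk₀ hMint
    (Padic.norm_p_lt_one) hfe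
  have h1 := congrArg (coeff 1) h0
  rw [hM, coeff_C_mul, coeff_one_formalLog, mul_one, map_zero] at h1
  exact pow_ne_zero N (Nat.cast_ne_zero.mpr hprime.ne_zero) h1

/-- **At `p = 2`: `a₁` odd ⟹ `log` unbounded** (`[2](t) = 2t − a₁t² + ⋯`, `coeff_two_formalMul_two`;
for a `2`-integral equation with good reduction, `a₁ ∈ ℤ₂ˣ` is ordinarity: `j̃ ≠ 0`).
[Silverman AEC IV.2.3, A.1.1(c)] [cite: SilvermanAEC2009, IV.2.3] -/
theorem unbounded_formalLog_two_of_norm_a₁_eq_one (V : WeierstrassCurve ℚ_[2]) [V.IsIntegral ℤ_[2]]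
    (ha : ‖V.a₁‖ = 1) : ∀ N : ℕ, ∃ m, ((2 : ℕ) : ℝ) ^ N < ‖coeff m V.formalLog‖ :=
  V.unbounded_formalLog_of_norm_coeff_formalMul_eq_one ⟨2, by rw [coeff_two_formalMul_two, norm_neg, ha]⟩

/-- **Good reduction ⟹ `log` unbounded, EVERY prime** (`p = 2, 3` and supersingular primes included):
for a Weierstrass equation `V₀/ℤ_p` with elliptic generic and special fibres the reduced formal group
has finite height (`exists_isUnit_coeff_formalMul'`: some coefficient of `[p]` is a unit), so the
coefficients of `log_{V₀ ⊗ ℚ_p}` are `p`-adically unbounded. [Silverman AEC IV.7.2, IV.6.1]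
[cite: SilvermanAEC2009, IV.7.2] -/
theorem unbounded_formalLog_of_isElliptic_toZMod (V₀ : WeierstrassCurve ℤ_[p])
    [(V₀.map PadicInt.Coe.ringHom).IsElliptic] [(V₀.map PadicInt.toZMod).IsElliptic] :
    ∀ N : ℕ, ∃ m, (p : ℝ) ^ N < ‖coeff m (V₀.baseChange ℚ_[p]).formalLog‖ := by
  haveI : (V₀.baseChange ℚ_[p]).IsIntegral ℤ_[p] := ⟨⟨V₀, rfl⟩⟩
  obtain ⟨d, -, hd⟩ := V₀.exists_isUnit_coeff_formalMul' (Fact.out : p.Prime).pos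
  refine (V₀.baseChange ℚ_[p]).unbounded_formalLog_of_norm_coeff_formalMul_eq_one ⟨d, ?_⟩
  have hmap : (V₀.baseChange ℚ_[p]).formalMul p =
      PowerSeries.map PadicInt.Coe.ringHom (V₀.formalMul p) := by
    rw [map_formalMul, baseChange, algebraMap_padicInt_eq]
  rw [hmap, coeff_map]
  exact PadicInt.isUnit_iff.mp hd

/-! ### §3. Uniqueness of the sigma-squared pair from unbounded denominators of `log` -/

section SqUnique

variable (V : WeierstrassCurve ℚ_[p])

variable {V} in
/-- **Two normalised ODD formal solutions of the sigma equation with the SAME constant coincide**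
(no integrality): the Wronskian `s₁'s₂ − s₂'s₁ = κ·ω·s₁s₂` has constant term
`κ = [t²]σ₁ − [t²]σ₂ = a₁/2 − a₁/2 = 0`, so `(s₁/s₂)' = 0`. (The tree's
`IsMazurTateSigmaPair.eq_of_const_eq`, with the integrality field it does not use removed.)
[Mazur–Stein–Tate 2006, §3.1 (the constants of integration), Rem. 1.4] [cite: MazurSteinTate2006, Thm. 1.3] -/
theorem eq_of_satisfiesSigmaODE_of_isFormallyOdd {σ₁ σ₂ : ℚ_[p]⟦X⟧} {c : ℚ_[p]}
    (h10 : constantCoeff σ₁ = 0) (h11 : coeff 1 σ₁ = 1) (hodd1 : V.IsFormallyOdd σ₁)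
    (hODE1 : V.SatisfiesSigmaODE σ₁ c)
    (h20 : constantCoeff σ₂ = 0) (h21 : coeff 1 σ₂ = 1) (hodd2 : V.IsFormallyOdd σ₂)
    (hODE2 : V.SatisfiesSigmaODE σ₂ c) : σ₁ = σ₂ := by
  set s₁ := sigmaShift σ₁ with hs₁
  set s₂ := sigmaShift σ₂ with hs₂
  -- (1) `g₁ - g₂ = κ t`
  have hcoeff : ∀ k, coeff (k + 2) (V.sigmaG σ₁ - V.sigmaG σ₂) = 0 := fun k => by
    have e := V.sub_mul_coeff_formalOmega_of_ode hODE1 hODE2 k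
    rw [sub_self, zero_mul, zero_eq_neg] at e
    exact (mul_eq_zero.mp e).resolve_left (Nat.cast_add_one_ne_zero k)
  set κ : ℚ_[p] := coeff 1 (V.sigmaG σ₁ - V.sigmaG σ₂) with hκ
  have hg : V.sigmaG σ₁ = V.sigmaG σ₂ + C κ * X := by
    rw [← sub_eq_iff_eq_add']
    ext n
    rcases n with _ | _ | k
    · rw [coeff_zero_eq_constantCoeff_apply, map_sub, V.constantCoeff_sigmaG h11,
        V.constantCoeff_sigmaG h21, sub_self, coeff_zero_eq_constantCoeff_apply]
      simp
    · simp [hκ]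
    · rw [hcoeff k, coeff_C_mul, coeff_X, if_neg (by omega), mul_zero]
  -- (2) the Wronskian identity `κ ω s₁ s₂ = s₁' s₂ - s₂' s₁`
  have E1 := V.sigmaG_mul h11
  have E2 := V.sigmaG_mul h21
  rw [hg] at E1
  have hW : C κ * V.formalOmega * s₁ * s₂ = d⁄dX ℚ_[p] s₁ * s₂ - d⁄dX ℚ_[p] s₂ * s₁ := by
    apply mul_left_cancel₀ (X_ne_zero (R := ℚ_[p]))
    calc X * (C κ * V.formalOmega * s₁ * s₂)
        = (V.sigmaG σ₂ + C κ * X) * (V.formalOmega * s₁) * s₂ -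
            V.sigmaG σ₂ * (V.formalOmega * s₂) * s₁ := by ring
      _ = (s₁ + X * d⁄dX ℚ_[p] s₁) * s₂ - (s₂ + X * d⁄dX ℚ_[p] s₂) * s₁ := by rw [E1, E2]
      _ = X * (d⁄dX ℚ_[p] s₁ * s₂ - d⁄dX ℚ_[p] s₂ * s₁) := by ring
  -- (3) its constant term: `κ = [t²]σ₁ - [t²]σ₂ = 0` by oddness
  have h22 : coeff 2 σ₁ = coeff 2 σ₂ :=
    mul_left_cancel₀ (two_ne_zero : (2 : ℚ_[p]) ≠ 0)
      (by rw [V.two_mul_coeff_two_of_isFormallyOdd hodd1 h10 h11,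
        V.two_mul_coeff_two_of_isFormallyOdd hodd2 h20 h21])
  have hκ0 : κ = 0 := by
    have e := congrArg constantCoeff hW
    simp only [map_mul, map_sub, constantCoeff_C, V.constantCoeff_formalOmega, hs₁, hs₂,
      constantCoeff_sigmaShift, h11, h21, mul_one, constantCoeff_derivative, coeff_sigmaShift, h22,
      sub_self] at e
    exact e
  -- (4) `s₁' s₂ = s₂' s₁`, hence `(s₁/s₂)' = 0` and `s₁ = s₂`
  rw [hκ0, map_zero, zero_mul, zero_mul, zero_mul, eq_comm, sub_eq_zero] at hW
  have hs₂0 : constantCoeff s₂ = 1 := by rw [hs₂, constantCoeff_sigmaShift, h21]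
  have hv : s₂ * invOfUnit s₂ 1 = 1 := mul_invOfUnit s₂ 1 (by rw [hs₂0, Units.val_one])
  set v := invOfUnit s₂ 1 with hvdef
  have hdv : s₂ * d⁄dX ℚ_[p] v + v * d⁄dX ℚ_[p] s₂ = 0 := by
    have e := congrArg (d⁄dX ℚ_[p]) hv
    rwa [Derivation.leibniz, smul_eq_mul, smul_eq_mul, Derivation.map_one_eq_zero] at e
  have hdu : d⁄dX ℚ_[p] (s₁ * v) = 0 := by
    have hs₂ne : s₂ ≠ 0 := fun h0 => by rw [h0, map_zero] at hs₂0; exact zero_ne_one hs₂0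
    refine (mul_eq_zero.mp ?_).resolve_left hs₂ne
    calc s₂ * d⁄dX ℚ_[p] (s₁ * v)
        = v * (d⁄dX ℚ_[p] s₁ * s₂ - d⁄dX ℚ_[p] s₂ * s₁) +
            s₁ * (s₂ * d⁄dX ℚ_[p] v + v * d⁄dX ℚ_[p] s₂) := by
          rw [Derivation.leibniz, smul_eq_mul, smul_eq_mul]; ring
      _ = 0 := by rw [hW, hdv, sub_self, mul_zero, mul_zero, add_zero]
  have hu : s₁ * v = 1 := by
    ext n
    rcases n with _ | n
    · rw [coeff_zero_eq_constantCoeff_apply, coeff_zero_eq_constantCoeff_apply, map_mul, map_one,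
        hs₁, constantCoeff_sigmaShift, h11, one_mul, hvdef, constantCoeff_invOfUnit, inv_one,
        Units.val_one]
    · have e := congrArg (coeff n) hdu
      rw [coeff_derivative, map_zero] at e
      rw [coeff_one, if_neg (Nat.succ_ne_zero n)]
      exact (mul_eq_zero.mp e).resolve_right (Nat.cast_add_one_ne_zero n)
  have hss : s₁ = s₂ := by
    calc s₁ = s₁ * (s₂ * v) := by rw [hv, mul_one]
      _ = (s₁ * v) * s₂ := by ring
      _ = s₂ := by rw [hu, one_mul]
  rw [← X_mul_sigmaShift h10, ← X_mul_sigmaShift h20, ← hs₁, ← hs₂, hss]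

variable {V} in
/-- **`2·g_σ = t·Σ'/(ω·Σ) ∈ ℤ_p⟦t⟧` for `Σ = σ² ∈ t² + t³ℤ_p⟦t⟧`** (`g_σ = tσ'/(ωσ) = sigmaG`), even
when `σ` itself is not integral (the case `p = 2`, `a₁` odd): `2g·(ωS) = 2S + tS'`, `S = Σ/t²`.
[Mazur–Tate 1991, Thm. 3.1 (bounded coefficients); Silverman 2005, §5 Rem. 2] [folklore] -/
private theorem isPadicInt_two_mul_sigmaG [V.IsIntegral ℤ_[p]] {σ : ℚ_[p]⟦X⟧}
    (h0 : constantCoeff σ = 0) (h1 : coeff 1 σ = 1) (hint : IsPadicInt (σ ^ 2)) :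
    IsPadicInt (2 * V.sigmaG σ) := by
  set s := sigmaShift σ with hs
  have hσ : X * s = σ := X_mul_sigmaShift h0
  set S := s ^ 2 with hSdef
  have hS : IsPadicInt S := by
    rw [isPadicInt_iff_coeff]
    intro n
    have h := isPadicInt_iff_coeff.mp hint (n + 2)
    rwa [← hσ, mul_pow, coeff_X_pow_mul] at h
  have hs0 : constantCoeff s = 1 := by rw [hs, constantCoeff_sigmaShift, h1]
  have hS0 : constantCoeff S = 1 := by rw [hSdef, map_pow, hs0, one_pow]
  have hωS0 : constantCoeff (V.formalOmega * S) = 1 := by rw [map_mul, V.constantCoeff_formalOmega, hS0, one_mul]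
  have hg := V.sigmaG_mul h1
  rw [← hs] at hg
  have hid : (2 * V.sigmaG σ) * (V.formalOmega * S) = 2 * S + X * d⁄dX ℚ_[p] S := by
    rw [hSdef, pow_two, Derivation.leibniz, smul_eq_mul]
    linear_combination (2 * s) * hg
  have hinv : (V.formalOmega * S) * invOfUnit (V.formalOmega * S) 1 = 1 :=
    mul_invOfUnit _ 1 (by rw [hωS0, Units.val_one])
  have h2g : 2 * V.sigmaG σ = (2 * S + X * d⁄dX ℚ_[p] S) * invOfUnit (V.formalOmega * S) 1 := by
    calc 2 * V.sigmaG σ = 2 * V.sigmaG σ * ((V.formalOmega * S) * invOfUnit (V.formalOmega * S) 1) := by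
          rw [hinv, mul_one]
      _ = (2 * S + X * d⁄dX ℚ_[p] S) * invOfUnit (V.formalOmega * S) 1 := by rw [← mul_assoc, hid]
  rw [h2g, two_mul]
  exact ((hS.add hS).add (IsPadicInt.powerSeries_X.mul hS.derivative)).mul
    ((V.isPadicInt_formalOmega.mul hS).invOfUnit_one hωS0)

variable {V} in
/-- **`2(c₁ − c₂)·log_V ∈ ℤ_p⟦t⟧` for two sigma-squared pairs** of a `p`-integral equation: writing
`Σᵢ = σᵢ²` (`exists_sq_eq`), `(c₁ − c₂)·[t^{k+1}]log = −[t^{k+2}](g₁ − g₂)` and `2gᵢ ∈ ℤ_p⟦t⟧`.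
[Mazur–Tate 1991, proof of Thm. 3.1; Silverman 2005, §5 Rem. 2] [cite: MazurTate1991, Thm. 3.1] -/
theorem IsMazurTateSigmaSqPair.norm_two_mul_sub_mul_coeff_formalLog_le [V.IsIntegral ℤ_[p]]
    {Sq₁ Sq₂ : ℚ_[p]⟦X⟧} {c₁ c₂ : ℚ_[p]} (h₁ : V.IsMazurTateSigmaSqPair Sq₁ c₁)
    (h₂ : V.IsMazurTateSigmaSqPair Sq₂ c₂) (m : ℕ) :
    ‖2 * (c₁ - c₂) * coeff m V.formalLog‖ ≤ 1 := by
  obtain ⟨σ₁, h10, h11, -, hODE1, hSq1⟩ := h₁.exists_sq_eq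
  obtain ⟨σ₂, h20, h21, -, hODE2, hSq2⟩ := h₂.exists_sq_eq
  rcases m with _ | k
  · rw [coeff_zero_eq_constantCoeff, V.constantCoeff_formalLog, mul_zero, norm_zero]
    exact zero_le_one
  · have e := V.sub_mul_coeff_formalLog_of_ode hODE1 hODE2 k
    have e2 : 2 * (c₁ - c₂) * coeff (k + 1) V.formalLog =
        -coeff (k + 2) (2 * V.sigmaG σ₁ - 2 * V.sigmaG σ₂) := by
      rw [show (2 : ℚ_[p]⟦X⟧) * V.sigmaG σ₁ - 2 * V.sigmaG σ₂ =
          C (2 : ℚ_[p]) * (V.sigmaG σ₁ - V.sigmaG σ₂) by rw [map_ofNat]; ring, coeff_C_mul]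
      linear_combination 2 * e
    rw [e2, norm_neg]
    have hi1 : IsPadicInt (2 * V.sigmaG σ₁) :=
      isPadicInt_two_mul_sigmaG h10 h11 (hSq1 ▸ isPadicInt_iff_coeff.mpr h₁.norm_coeff_le)
    have hi2 : IsPadicInt (2 * V.sigmaG σ₂) :=
      isPadicInt_two_mul_sigmaG h20 h21 (hSq2 ▸ isPadicInt_iff_coeff.mpr h₂.norm_coeff_le)
    exact isPadicInt_iff_coeff.mp (hi1.sub hi2) _

variable {V} in
/-- **The constants of two sigma-squared pairs agree** when `log_V` has unbounded coefficients.
[Mazur–Tate 1991, Thm. 3.1; Silverman 2005, §5 Rem. 2 («unique»)] [cite: MazurTate1991, Thm. 3.1] -/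
theorem IsMazurTateSigmaSqPair.const_eq_of_unbounded_formalLog [V.IsIntegral ℤ_[p]]
    (hlog : ∀ N : ℕ, ∃ m, (p : ℝ) ^ N < ‖coeff m V.formalLog‖)
    {Sq₁ Sq₂ : ℚ_[p]⟦X⟧} {c₁ c₂ : ℚ_[p]} (h₁ : V.IsMazurTateSigmaSqPair Sq₁ c₁)
    (h₂ : V.IsMazurTateSigmaSqPair Sq₂ c₂) : c₁ = c₂ := by
  by_contra hne
  have hδ : 0 < ‖(2 : ℚ_[p]) * (c₁ - c₂)‖ :=
    norm_pos_iff.mpr (mul_ne_zero two_ne_zero (sub_ne_zero.mpr hne))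
  have hp1 : (1 : ℝ) < p := by exact_mod_cast (Fact.out : p.Prime).one_lt
  obtain ⟨N, hN⟩ := pow_unbounded_of_one_lt ‖(2 : ℚ_[p]) * (c₁ - c₂)‖⁻¹ hp1
  obtain ⟨m, hm⟩ := hlog N
  have h := h₁.norm_two_mul_sub_mul_coeff_formalLog_le h₂ m
  rw [norm_mul] at h
  have h2 : 1 < ‖(2 : ℚ_[p]) * (c₁ - c₂)‖ * ‖coeff m V.formalLog‖ := by
    rw [← mul_inv_cancel₀ hδ.ne']
    exact mul_lt_mul_of_pos_left (hN.trans hm) hδ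
  linarith

variable {V} in
/-- **Uniqueness of the sigma-squared pair, given unbounded denominators of `log_V`** — the squared
twin of `IsMazurTateSigmaPair.unique_of_unbounded_formalLog`, valid at `p = 2`.
[Mazur–Tate 1991, Thm. 3.1; Silverman 2005, §5 Rem. 2] [cite: MazurTate1991, Thm. 3.1]
[cite: Silverman2005DivPoly, §5 Rem. 2] -/
theorem IsMazurTateSigmaSqPair.unique_of_unbounded_formalLog [V.IsIntegral ℤ_[p]]
    (hlog : ∀ N : ℕ, ∃ m, (p : ℝ) ^ N < ‖coeff m V.formalLog‖)
    {Sq₁ Sq₂ : ℚ_[p]⟦X⟧} {c₁ c₂ : ℚ_[p]} (h₁ : V.IsMazurTateSigmaSqPair Sq₁ c₁)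
    (h₂ : V.IsMazurTateSigmaSqPair Sq₂ c₂) : Sq₁ = Sq₂ ∧ c₁ = c₂ := by
  obtain rfl := h₁.const_eq_of_unbounded_formalLog hlog h₂
  obtain ⟨σ₁, h10, h11, hodd1, hODE1, hSq1⟩ := h₁.exists_sq_eq
  obtain ⟨σ₂, h20, h21, hodd2, hODE2, hSq2⟩ := h₂.exists_sq_eq
  rw [hSq1, hSq2, V.eq_of_satisfiesSigmaODE_of_isFormallyOdd h10 h11 hodd1 hODE1 h20 h21 hodd2 hODE2]
  exact ⟨rfl, rfl⟩

/-- **Existence alone gives `∃!`** for the sigma-squared pair (unbounded `log_V`).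
[Mazur–Tate 1991, Thm. 3.1] [cite: MazurTate1991, Thm. 3.1] -/
theorem existsUnique_isMazurTateSigmaSqPair_of_exists [V.IsIntegral ℤ_[p]]
    (hlog : ∀ N : ℕ, ∃ m, (p : ℝ) ^ N < ‖coeff m V.formalLog‖)
    (hex : ∃ Sq : ℚ_[p]⟦X⟧, ∃ c, V.IsMazurTateSigmaSqPair Sq c) :
    ∃! Sc : ℚ_[p]⟦X⟧ × ℚ_[p], V.IsMazurTateSigmaSqPair Sc.1 Sc.2 := by
  obtain ⟨Sq, c, h⟩ := hex
  refine ⟨(Sq, c), h, fun Sc h' => ?_⟩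
  obtain ⟨e1, e2⟩ := h'.unique_of_unbounded_formalLog hlog h
  exact Prod.ext e1 e2

/-- **Uniqueness of the Mazur–Tate pair `(σ, c)` at EVERY good prime** (`ℤ_p`-model with elliptic
fibres; `p = 2, 3` included — vacuous but true at supersingular `p`): the tree's
`IsMazurTateSigmaPair.unique_of_unbounded_formalLog` fed by finite height. [Mazur–Stein–Tate 2006,
Thm. 1.3; Mazur–Tate 1991, Thm. 3.1] [cite: MazurSteinTate2006, Thm. 1.3] -/
theorem IsMazurTateSigmaPair.unique_of_isElliptic_toZMod (V₀ : WeierstrassCurve ℤ_[p])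
    [(V₀.map PadicInt.Coe.ringHom).IsElliptic] [(V₀.map PadicInt.toZMod).IsElliptic]
    {σ₁ σ₂ : ℚ_[p]⟦X⟧} {c₁ c₂ : ℚ_[p]} (h₁ : (V₀.baseChange ℚ_[p]).IsMazurTateSigmaPair σ₁ c₁)
    (h₂ : (V₀.baseChange ℚ_[p]).IsMazurTateSigmaPair σ₂ c₂) : σ₁ = σ₂ ∧ c₁ = c₂ := by
  haveI : (V₀.baseChange ℚ_[p]).IsIntegral ℤ_[p] := ⟨⟨V₀, rfl⟩⟩
  exact h₁.unique_of_unbounded_formalLog (unbounded_formalLog_of_isElliptic_toZMod V₀) h₂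

/-- **Uniqueness of the sigma-squared pair `(Σ, c)` at EVERY good prime** (`ℤ_p`-model with elliptic
fibres, `p = 2` included). [Mazur–Tate 1991, Thm. 3.1; Silverman 2005, §5 Rem. 2]
[cite: MazurTate1991, Thm. 3.1] -/
theorem IsMazurTateSigmaSqPair.unique_of_isElliptic_toZMod (V₀ : WeierstrassCurve ℤ_[p])
    [(V₀.map PadicInt.Coe.ringHom).IsElliptic] [(V₀.map PadicInt.toZMod).IsElliptic]
    {Sq₁ Sq₂ : ℚ_[p]⟦X⟧} {c₁ c₂ : ℚ_[p]} (h₁ : (V₀.baseChange ℚ_[p]).IsMazurTateSigmaSqPair Sq₁ c₁)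
    (h₂ : (V₀.baseChange ℚ_[p]).IsMazurTateSigmaSqPair Sq₂ c₂) : Sq₁ = Sq₂ ∧ c₁ = c₂ := by
  haveI : (V₀.baseChange ℚ_[p]).IsIntegral ℤ_[p] := ⟨⟨V₀, rfl⟩⟩
  exact h₁.unique_of_unbounded_formalLog (unbounded_formalLog_of_isElliptic_toZMod V₀) h₂

end SqUnique

/-! ### §4. `p = 2`: uniqueness for `a₁` odd, and `X₀(49)` binder-free -/

section Two

/-- **Uniqueness of the sigma-squared pair at `p = 2` for `a₁ ∈ ℤ₂ˣ`** (good ORDINARY reduction at `2`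
of a `2`-integral equation), with NO printed-fact binder: Mazur–Tate 1991 Thm. 3.1's uniqueness at
`p = 2` in the tree's differential-equation currency. [Mazur–Tate 1991, Thm. 3.1; Silverman 2005,
§5 Rem. 2] [cite: MazurTate1991, Thm. 3.1] [cite: Silverman2005DivPoly, §5 Rem. 2] -/
theorem IsMazurTateSigmaSqPair.unique_two_of_norm_a₁_eq_one (V : WeierstrassCurve ℚ_[2])
    [V.IsIntegral ℤ_[2]] (ha : ‖V.a₁‖ = 1) {Sq₁ Sq₂ : ℚ_[2]⟦X⟧} {c₁ c₂ : ℚ_[2]}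
    (h₁ : V.IsMazurTateSigmaSqPair Sq₁ c₁) (h₂ : V.IsMazurTateSigmaSqPair Sq₂ c₂) :
    Sq₁ = Sq₂ ∧ c₁ = c₂ :=
  h₁.unique_of_unbounded_formalLog (V.unbounded_formalLog_two_of_norm_a₁_eq_one ha) h₂

/-- **`X₀(49) ⊗ ℚ₂` has EXACTLY ONE sigma-squared pair, binder-free** (`a₁ = 1`; existence is
`cm7_exists_isMazurTateSigmaSqPair_sq_two`). Compare `cm7_exists_isMazurTateSigmaSqPair_two (hMT)`.
[Mazur–Tate 1991, Thm. 3.1; Perrin-Riou 1984, Ch. III §1.2 Lemme 2] [cite: MazurTate1991, Thm. 3.1] -/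
theorem cm7_existsUnique_isMazurTateSigmaSqPair_two :
    ∃! Sc : ℚ_[2]⟦X⟧ × ℚ_[2], (cm7.baseChange ℚ_[2]).IsMazurTateSigmaSqPair Sc.1 Sc.2 := by
  haveI := cm7_isGloballyMinimal
  have ha : ‖(cm7.baseChange ℚ_[2]).a₁‖ = 1 := by
    rw [show (cm7.baseChange ℚ_[2]).a₁ = 1 by simp [WeierstrassCurve.baseChange, WeierstrassCurve.map],
      norm_one]
  obtain ⟨σ, -, -, -, -, h⟩ := cm7_exists_isMazurTateSigmaSqPair_sq_two
  exact (cm7.baseChange ℚ_[2]).existsUnique_isMazurTateSigmaSqPair_of_exists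
    ((cm7.baseChange ℚ_[2]).unbounded_formalLog_two_of_norm_a₁_eq_one ha) ⟨σ ^ 2, 0, h⟩

/-- **(L1) at `p = 2` for `X₀(49)`, BINDER-FREE: `Σ₂ = σ_CM²` and `c₂ = 0`.** The tree's canonical
squared `2`-adic sigma function `padicSigmaSq (X₀(49) ⊗ ℚ₂)` IS the square of Perrin-Riou's CM sigma
function — of any (= the) normalised odd formal solution `σ` of `x = −D(Dσ/σ)` on `[1,−1,0,−2,−1]` —
and `padicSigmaSqConst = 0`; no printed fact is assumed (compare `cm7_padicSigmaSq_eq_sq_two (hMT)`).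
[Perrin-Riou 1984, Ch. III §1.2 Lemme 2 and p. 54 («se déduit des résultats de Mazur et Tate»);
Mazur–Tate 1991, Thm. 3.1] [cite: Perrinriou1984, Ch. III §1.2 Lemme 2] [cite: MazurTate1991, Thm. 3.1] -/
theorem cm7_padicSigmaSq_eq_sq_two' {σ : ℚ_[2]⟦X⟧} (hσ0 : constantCoeff σ = 0) (hσ1 : coeff 1 σ = 1)
    (hodd : (cm7.baseChange ℚ_[2]).IsFormallyOdd σ) (hODE : (cm7.baseChange ℚ_[2]).SatisfiesSigmaODE σ 0) :
    (cm7.baseChange ℚ_[2]).padicSigmaSq = σ ^ 2 ∧ (cm7.baseChange ℚ_[2]).padicSigmaSqConst = 0 := by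
  obtain ⟨Sc, -, huniq⟩ := cm7_existsUnique_isMazurTateSigmaSqPair_two
  have e1 := huniq (_, _) cm7_isMazurTateSigmaSqPair_padicSigmaSq_two'
  have e2 := huniq (σ ^ 2, 0) (cm7_isMazurTateSigmaSqPair_sq_two hσ0 hσ1 hodd hODE)
  have e := e1.trans e2.symm
  exact ⟨congrArg Prod.fst e, congrArg Prod.snd e⟩

/-- **The squared Mazur–Tate constant of `X₀(49)` at `2` is `0`** (`s₂ = 1/4` on the minimal model),
binder-free. [Perrin-Riou 1984, Ch. III §1.2, table p. 54 (`s₂ = 1/2` on `y² = 4x³ − 35x − 49`)]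
[cite: Perrinriou1984, Ch. III §1.2 Lemme 2] -/
theorem cm7_padicSigmaSqConst_two : (cm7.baseChange ℚ_[2]).padicSigmaSqConst = 0 := by
  obtain ⟨σ, h0, h1, hodd, hODE, -⟩ := cm7_exists_isMazurTateSigmaSqPair_sq_two
  exact (cm7_padicSigmaSq_eq_sq_two' h0 h1 hodd hODE).2

end Two

end WeierstrassCurve
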